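import Summits.ResolutionOfSingularities.ResolutionOfSingularities.Theorems.RadicialJungCleanModelsCcurvePersistPrelims
import Summits.ResolutionOfSingularities.ResolutionOfSingularities.Theorems.RadicialJungCleanModelsCleanLU3CompositeCurveStep
import HarnessLib

/-!
# Route `RadicialJung`, crux `CleanModels` (stmt-15917) — (C-curve) sub-line: packaging a monomial representative into loose-clean form (1)

Lead `res-B-lead-1` g7 (plan `Cruxes/CleanModels/Lines/Sketch-memo-Ccurve-plan.md` §1 S5; workfile `Lines/Sketch_Ccurve_assembly.lean` v2.8, stubs
`stub_Cc_persistForm1/3`).  OURS · counted 0.  Nothing here proves resolution in characteristic `p`; resolution in char `p` is NOT proved.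

End of the closed-point persist: on a model `A'` (f.g., inside `O`, above `A`) regular of dimension 3 at the centre of `O` with regular system of parameters
`(z, P, Q)`, a representative `Σ c_j^p g₀^j = 𝒰 · z^E · P^{a₀} · Q^{a₁}` (`𝒰` a unit, `p ∤ a₀, a₁`; `pack_two`) or `= 𝒰 · z^E · P^{a₀}` (`pack_one`) of the
`K^p`-line of `g₀` is put in loose-clean FORM (1): write `E = p q + r`, rescale `c ↦ c / z^q` (`z^{-pq}` is a `p`-th power), and take the r.s.p. `(P, Q, z)` with
exponents `(a₀, a₁)` if `r = 0`, else `(z, P, Q)` with exponents `(r, a₀, a₁)` (`0 < r < p`).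
-/

noncomputable section

set_option linter.dupNamespace false

open IsLocalRing Literature.AlgebraicGeometry.Resolution
open Summit.ResolutionOfSingularities.ResolutionOfSingularities.Theorems

namespace Summit.ResolutionOfSingularities.ResolutionOfSingularities.Theorems.RadicialJung.CleanModels.Ccurve

variable {k : Type} [Field k] {K : Type} [Field K] [Algebra k K]

/-- **Packaging, two transversal factors.**  On a model `A'` regular of dimension `3` at the centre of `O` with r.s.p. `(z, P, Q)`, a representative
`Σ c_j^p g₀^j = 𝒰 · z^E · P^{a₀} · Q^{a₁}` with `𝒰` a unit and `p ∤ a₀`, `p ∤ a₁` yields loose-clean form (1) after the `K^p`-rescaling `c ↦ c / z^{⌊E/p⌋}`. [folklore] -/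
theorem pack_two (p : ℕ) (hp : p.Prime) (O : ValuationSubring K) (A A' : Subalgebra k K)
    (hA'O : A'.toSubring ≤ O.toSubring) (hAA' : A ≤ A') (hA'fg : A'.FG)
    (hreg : IsRegularLocalRing ↥(locAtCentre A'.toSubring O)) (hdim : ringKrullDim ↥(locAtCentre A'.toSubring O) = 3)
    (g₀ : K) (z P Q 𝒰 : K) (hz : z ∈ locAtCentre A'.toSubring O) (hP : P ∈ locAtCentre A'.toSubring O) (hQ : Q ∈ locAtCentre A'.toSubring O)
    (h𝒰 : 𝒰 ∈ locAtCentre A'.toSubring O) (hv𝒰 : O.valuation 𝒰 = 1) (hz0 : z ≠ 0)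
    (hmax : (haveI := isLocalRing_locAtCentre hA'O; IsLocalRing.maximalIdeal (locAtCentre A'.toSubring O)) =
      Ideal.span {⟨z, hz⟩, ⟨P, hP⟩, ⟨Q, hQ⟩})
    (c : Fin p → K) (hc : ∃ j : Fin p, (j : ℕ) ≠ 0 ∧ c j ≠ 0) (E a₀ a₁ : ℕ) (ha₀ : ¬ p ∣ a₀) (ha₁ : ¬ p ∣ a₁)
    (hG : (∑ j : Fin p, c j ^ p * g₀ ^ (j : ℕ)) = 𝒰 * z ^ E * P ^ a₀ * Q ^ a₁) :
    ∃ (A' : Subalgebra k K), A'.toSubring ≤ O.toSubring ∧ A ≤ A' ∧ A'.FG ∧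
    ∃ (_ : IsRegularLocalRing ↥(locAtCentre A'.toSubring O)) (c : Fin p → K), (∃ j : Fin p, (j : ℕ) ≠ 0 ∧ c j ≠ 0) ∧
    ((∃ (d m : ℕ) (hmd : m ≤ d) (t : Fin d → ↥(locAtCentre A'.toSubring O)) (a : Fin m → ℕ) (u : ↥(locAtCentre A'.toSubring O)), IsUnit u ∧
    Ideal.span (Set.range t) = IsLocalRing.maximalIdeal ↥(locAtCentre A'.toSubring O) ∧
    ringKrullDim ↥(locAtCentre A'.toSubring O) = (d : WithBot ℕ∞) ∧ 0 < m ∧ (∀ i, ¬ p ∣ a i) ∧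
    (∑ j : Fin p, c j ^ p * g₀ ^ (j : ℕ)) = (u : K) * ∏ i : Fin m, ((t (Fin.castLE hmd i) : ↥(locAtCentre A'.toSubring O)) : K) ^ (a i)) ∨
    (∃ u : ↥(locAtCentre A'.toSubring O), IsUnit u ∧ (∑ j : Fin p, c j ^ p * g₀ ^ (j : ℕ)) = (u : K) ∧
    ∀ c' : ↥(locAtCentre A'.toSubring O), u - c' ^ p ∉ IsLocalRing.maximalIdeal ↥(locAtCentre A'.toSubring O)) ∨
    (∃ s c' : ↥(locAtCentre A'.toSubring O), (∑ j : Fin p, c j ^ p * g₀ ^ (j : ℕ)) = (s : K) ∧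
    s - c' ^ p ∈ IsLocalRing.maximalIdeal ↥(locAtCentre A'.toSubring O) ∧
    s - c' ^ p ∉ IsLocalRing.maximalIdeal ↥(locAtCentre A'.toSubring O) ^ 2)) := by
  classical
  haveI := isLocalRing_locAtCentre hA'O
  haveI : IsRegularLocalRing ↥(locAtCentre A'.toSubring O) := hreg
  have h𝒰unit : IsUnit (⟨𝒰, h𝒰⟩ : ↥(locAtCentre A'.toSubring O)) := isUnit_locAtCentre_of_valuation_eq_one hA'O h𝒰 hv𝒰
  -- exponent reduction `E = p q + r`
  set q : ℕ := E / p with hq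
  set r : ℕ := E % p with hr
  have hE : E = p * q + r := (Nat.div_add_mod E p).symm
  have hrp : r < p := Nat.mod_lt _ hp.pos
  have hzq0 : z ^ q ≠ 0 := pow_ne_zero _ hz0
  let c' : Fin p → K := fun j => c j * (z ^ q)⁻¹
  have hc' : ∃ j : Fin p, (j : ℕ) ≠ 0 ∧ c' j ≠ 0 := exists_ne_zero_mul_of_exists hc (inv_ne_zero hzq0)
  have hG' : (∑ j : Fin p, c' j ^ p * g₀ ^ (j : ℕ)) = 𝒰 * z ^ r * P ^ a₀ * Q ^ a₁ := by
    change (∑ j : Fin p, (c j * (z ^ q)⁻¹) ^ p * g₀ ^ (j : ℕ)) = _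
    rw [sum_mul_pow_rescale, hG, hE, pow_add, pow_mul, inv_pow]
    field_simp
    rw [← pow_mul, ← pow_mul, Nat.mul_comm p q]; ring
  refine ⟨A', hA'O, hAA', hA'fg, hreg, c', hc', Or.inl ?_⟩
  by_cases hr0 : r = 0
  · -- `t = (P, Q, z)`, `a = (a₀, a₁)`
    refine ⟨3, 2, by norm_num, ![⟨P, hP⟩, ⟨Q, hQ⟩, ⟨z, hz⟩], ![a₀, a₁], ⟨𝒰, h𝒰⟩, h𝒰unit, ?_, hdim, by norm_num, ?_, ?_⟩
    · rw [range_vec3, hmax]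
      congr 1; ext v; simp only [Set.mem_insert_iff, Set.mem_singleton_iff]; tauto
    · intro i; fin_cases i
      · exact ha₀
      · exact ha₁
    · rw [hG', hr0, pow_zero, mul_one, Fin.prod_univ_two]
      simp [Fin.castLE, mul_assoc]
  · -- `t = (z, P, Q)`, `a = (r, a₀, a₁)`
    have hrnd : ¬ p ∣ r := fun h => hr0 (Nat.eq_zero_of_dvd_of_lt h hrp)
    refine ⟨3, 3, le_rfl, ![⟨z, hz⟩, ⟨P, hP⟩, ⟨Q, hQ⟩], ![r, a₀, a₁], ⟨𝒰, h𝒰⟩, h𝒰unit, ?_, hdim, by norm_num, ?_, ?_⟩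
    · rw [range_vec3, hmax]
    · intro i; fin_cases i
      · exact hrnd
      · exact ha₀
      · exact ha₁
    · rw [hG', Fin.prod_univ_three]
      simp [Fin.castLE, mul_assoc]

/-- **Packaging, one factor.**  As `pack_two` with `Σ c_j^p g₀^j = 𝒰 · z^E · P^{a₀}` (`(z, P, Q)` an r.s.p., `p ∤ a₀`). [folklore] -/
theorem pack_one (p : ℕ) (hp : p.Prime) (O : ValuationSubring K) (A A' : Subalgebra k K)
    (hA'O : A'.toSubring ≤ O.toSubring) (hAA' : A ≤ A') (hA'fg : A'.FG)
    (hreg : IsRegularLocalRing ↥(locAtCentre A'.toSubring O)) (hdim : ringKrullDim ↥(locAtCentre A'.toSubring O) = 3)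
    (g₀ : K) (z P Q 𝒰 : K) (hz : z ∈ locAtCentre A'.toSubring O) (hP : P ∈ locAtCentre A'.toSubring O) (hQ : Q ∈ locAtCentre A'.toSubring O)
    (h𝒰 : 𝒰 ∈ locAtCentre A'.toSubring O) (hv𝒰 : O.valuation 𝒰 = 1) (hz0 : z ≠ 0)
    (hmax : (haveI := isLocalRing_locAtCentre hA'O; IsLocalRing.maximalIdeal (locAtCentre A'.toSubring O)) =
      Ideal.span {⟨z, hz⟩, ⟨P, hP⟩, ⟨Q, hQ⟩})
    (c : Fin p → K) (hc : ∃ j : Fin p, (j : ℕ) ≠ 0 ∧ c j ≠ 0) (E a₀ : ℕ) (ha₀ : ¬ p ∣ a₀)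
    (hG : (∑ j : Fin p, c j ^ p * g₀ ^ (j : ℕ)) = 𝒰 * z ^ E * P ^ a₀) :
    ∃ (A' : Subalgebra k K), A'.toSubring ≤ O.toSubring ∧ A ≤ A' ∧ A'.FG ∧
    ∃ (_ : IsRegularLocalRing ↥(locAtCentre A'.toSubring O)) (c : Fin p → K), (∃ j : Fin p, (j : ℕ) ≠ 0 ∧ c j ≠ 0) ∧
    ((∃ (d m : ℕ) (hmd : m ≤ d) (t : Fin d → ↥(locAtCentre A'.toSubring O)) (a : Fin m → ℕ) (u : ↥(locAtCentre A'.toSubring O)), IsUnit u ∧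
    Ideal.span (Set.range t) = IsLocalRing.maximalIdeal ↥(locAtCentre A'.toSubring O) ∧
    ringKrullDim ↥(locAtCentre A'.toSubring O) = (d : WithBot ℕ∞) ∧ 0 < m ∧ (∀ i, ¬ p ∣ a i) ∧
    (∑ j : Fin p, c j ^ p * g₀ ^ (j : ℕ)) = (u : K) * ∏ i : Fin m, ((t (Fin.castLE hmd i) : ↥(locAtCentre A'.toSubring O)) : K) ^ (a i)) ∨
    (∃ u : ↥(locAtCentre A'.toSubring O), IsUnit u ∧ (∑ j : Fin p, c j ^ p * g₀ ^ (j : ℕ)) = (u : K) ∧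
    ∀ c' : ↥(locAtCentre A'.toSubring O), u - c' ^ p ∉ IsLocalRing.maximalIdeal ↥(locAtCentre A'.toSubring O)) ∨
    (∃ s c' : ↥(locAtCentre A'.toSubring O), (∑ j : Fin p, c j ^ p * g₀ ^ (j : ℕ)) = (s : K) ∧
    s - c' ^ p ∈ IsLocalRing.maximalIdeal ↥(locAtCentre A'.toSubring O) ∧
    s - c' ^ p ∉ IsLocalRing.maximalIdeal ↥(locAtCentre A'.toSubring O) ^ 2)) := by
  classical
  haveI := isLocalRing_locAtCentre hA'O
  haveI : IsRegularLocalRing ↥(locAtCentre A'.toSubring O) := hreg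
  have h𝒰unit : IsUnit (⟨𝒰, h𝒰⟩ : ↥(locAtCentre A'.toSubring O)) := isUnit_locAtCentre_of_valuation_eq_one hA'O h𝒰 hv𝒰
  set q : ℕ := E / p with hq
  set r : ℕ := E % p with hr
  have hE : E = p * q + r := (Nat.div_add_mod E p).symm
  have hrp : r < p := Nat.mod_lt _ hp.pos
  have hzq0 : z ^ q ≠ 0 := pow_ne_zero _ hz0
  let c' : Fin p → K := fun j => c j * (z ^ q)⁻¹
  have hc' : ∃ j : Fin p, (j : ℕ) ≠ 0 ∧ c' j ≠ 0 := exists_ne_zero_mul_of_exists hc (inv_ne_zero hzq0)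
  have hG' : (∑ j : Fin p, c' j ^ p * g₀ ^ (j : ℕ)) = 𝒰 * z ^ r * P ^ a₀ := by
    change (∑ j : Fin p, (c j * (z ^ q)⁻¹) ^ p * g₀ ^ (j : ℕ)) = _
    rw [sum_mul_pow_rescale, hG, hE, pow_add, pow_mul, inv_pow]
    field_simp
    rw [← pow_mul, ← pow_mul, Nat.mul_comm p q]; ring
  refine ⟨A', hA'O, hAA', hA'fg, hreg, c', hc', Or.inl ?_⟩
  by_cases hr0 : r = 0
  · -- `t = (P, Q, z)`, `a = (a₀)`
    refine ⟨3, 1, by norm_num, ![⟨P, hP⟩, ⟨Q, hQ⟩, ⟨z, hz⟩], ![a₀], ⟨𝒰, h𝒰⟩, h𝒰unit, ?_, hdim, Nat.one_pos, ?_, ?_⟩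
    · rw [range_vec3, hmax]
      congr 1; ext v; simp only [Set.mem_insert_iff, Set.mem_singleton_iff]; tauto
    · intro i; fin_cases i; exact ha₀
    · rw [hG', hr0, pow_zero, mul_one, Fin.prod_univ_one]
      simp [Fin.castLE]
  · -- `t = (z, P, Q)`, `a = (r, a₀)`
    have hrnd : ¬ p ∣ r := fun h => hr0 (Nat.eq_zero_of_dvd_of_lt h hrp)
    refine ⟨3, 2, by norm_num, ![⟨z, hz⟩, ⟨P, hP⟩, ⟨Q, hQ⟩], ![r, a₀], ⟨𝒰, h𝒰⟩, h𝒰unit, ?_, hdim, by norm_num, ?_, ?_⟩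
    · rw [range_vec3, hmax]
    · intro i; fin_cases i
      · exact hrnd
      · exact ha₀
    · rw [hG', Fin.prod_univ_two]
      simp [Fin.castLE, mul_assoc]

end Summit.ResolutionOfSingularities.ResolutionOfSingularities.Theorems.RadicialJung.CleanModels.Ccurve

end
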